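import Summits.QuantumFields.YangMills.Theorems.BalabanUVNodesN19LedgerPieces
import Summits.QuantumFields.YangMills.Theorems.BalabanUVNodesN19OtherKindsSpecies

/-!
# BalabanUVNodes ∕ N19 — THE FRAME's ONE ESTIMATE PIECE `FinestStepModConst` (lens s4′, `N19LedgerPieces`) FROM THE SPECIES DATA (lens s4″,
# `N19OtherKindsSpecies`): the junction of the two lens rows, by name

Cell `pub-ymgap`, HUMAN RULING D-0062 (Track A), node N19 = NE7, R134 seat dag-n19-c (g4), strategy s1; route `Summits/QuantumFields/YangMills/Theses/
BalabanUVNodes.lean` rev 15, cluster item K3′ «SpineGivenEndpointR12» (stmt-QuantumFields-19908); filed `--supports` that item `--as helper`.  COUNT-NEUTRAL.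

THE POINT.  dag-n19-d g4's `N19LedgerPieces` (p475201, lens row s4′) split the N19 frame `N19LedgerLinkSync.LedgerAtSync` into six named pieces
(`ledgerAtSync_iff_pieces`) and isolated its ONE estimate-bearing piece as the named predicate **`FinestStepModConst L l₀ vol T Bad R`** — «the finest step
matches a constant»: `other ∧ RO_le ∧ rO_summable ∧ cO_dev` on `L.oA″ L.oB″ L.cO″ L.RO″ L.rO″` — flagged «NOT PRINTED … to be routed by NODE O».  This
seat's `N19OtherKindsSpecies` (p476356, lens row s4″) proved that those clauses, plus `posO`, follow for `oA″ = exp α`, `oB″ = exp(Φ + e)·exp β` from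
SPECIES data carrying NO two-run estimate on road (ii): (α) run B's unmatched first step (`Φ`, `e`, one-run profile `|Φ| ≤ vol·ρ K` = [III] Thm 2
(2.43)∕(2.45) at age `K+1`, N11 by name) and (γ) the large-field normalisation constants (`α`, `β`, `τ`-free bulk `b₀`, recent-window deviation —
[Balaban1989LargeFieldII] p. 380's `O(1)·log g_j⁻²·|Z_j|` constants, g-dependent, priced by `N19ConstantsWindow` by name).  THIS FILE is the three-line
junction: for ANY ledger data `L : LedgerDataSync` whose remaining-kinds fields ARE the species forms, `FinestStepModConst L l₀ vol T Bad R` holds, and so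
does `LedgerOtherKinds`' positivity clause `posO` — i.e. the frame's one estimate is ROUTED, on road (ii), to one-run printed inputs + bookkeeping
(lens «decomp» v3 VERDICT, cards M9–M12; bookings B1–B3 remain NODE O's).
* `finestStepModConst_of_species` — abstract deviation datum `(b₀, s)`.
* `finestStepModConst_of_species_windowSum` — the deviation READ OFF the window letters (operations `ops K t τ ⊆ AllO K`, `Multiplicity`, `RecentOnly`,
  `|cn| ≤ Cn·θ′^{sc}·w`, the split `β − α = b₀ K + Σ_{ops} cn`), via `N19OtherKindsSpecies.constDev_le_windowSum`.
* `posO_of_species` — the `posO` field of `LedgerOtherKinds` ∕ `LedgerAtSync` for the same data.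

HONEST FRAMING.  Kernel bookkeeping (each theorem is ONE application of `N19OtherKindsSpecies.otherClause_of_species(_windowSum)` re-bundled into n19-d's
structure); the species data are HYPOTHESES (N11's one-run slice bound and the constants' form enter as binders); which species NODE O's instance of
`LedgerDataSync` has is NODE O's; NE7 ∕ (2.43) ∕ β-matching NOT proved; nothing of Bałaban's asserted beyond the locators; N19 NOT discharged; Track A
count unmoved (5∕27 · A 5∕28).  One finite four-torus at fixed ε, rung (B)+1 — NOT infinite volume, NOT OS on ℝ⁴, NOT a mass gap, NOT Clay.  THEOREMS
ONLY; 0 `def`; 0 `sorry`; standard axioms.  Edits nothing (`N19LedgerPieces`, `N19OtherKindsSpecies`, `N19LedgerLinkSync` stay as filed).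
-/

set_option autoImplicit false

noncomputable section

open Finset MeasureTheory
open scoped BigOperators

namespace Summit.QuantumFields.YangMills.BalabanUVNodes.N19FinestStepSpecies

open Literature.MathematicalPhysics.QuantumFieldTheory.Balaban1983to89
open T4OutputRate (Carriers)
open T4EtaRateMin (Readings)
open T4RecentScale (Multiplicity)
open T4GoodClassBudget (RecentOnly jlogOf)
open Summit.QuantumFields.YangMills.BalabanUVNodes.N19LedgerLinkSync (LedgerDataSync)
open Summit.QuantumFields.YangMills.BalabanUVNodes.N19LedgerPieces (FinestStepModConst)
open Summit.QuantumFields.YangMills.BalabanUVNodes.N19OtherKindsSpecies (otherClause_of_species otherClause_of_species_windowSum)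

variable {C : Carriers} {F : Type*} {ι X : Type} [MeasurableSpace ι] {σ : Type*} [DecidableEq σ]
  {L : LedgerDataSync C F ι σ} {l₀ vol : ℝ} {T : ℕ → Finset σ} {Bad : ℕ → ℝ → Finset σ} {R : Readings ι X}

/-- **THE FRAME's ONE ESTIMATE FROM THE SPECIES DATA** [bookkeeping].  If the ledger data's remaining kinds are the species forms — run A
`L.oA″ K t τ v = exp(α K t τ)` (normalisation constants only: run B's first step has no run-A partner), run B `L.oB″ K t τ v = exp(Φ K t τ v + e K)·exp(β K t τ)`
(first-step ledger `Φ` with `t, τ, v`-free constant `e K`, times its constants), centre `L.cO″ K t τ = e K + (β K t τ − α K t τ)`, radius `L.RO″ K t τ = vol·ρ K`,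
profile `L.rO″ = ρ` — and the species data hold — (α) the ONE-RUN profile bound `|Φ K t τ v| ≤ vol·ρ K` on good classes for admissible `v`, `Summable ρ`
((2.43)∕(2.45) at age `K+1`, N11 by name); (γ) a centre-deviation datum `|β − α − b₀ K| ≤ vol·s K`, `Summable s` — then n19-d's estimate piece
`N19LedgerPieces.FinestStepModConst L l₀ vol T Bad R` HOLDS.  One application of `N19OtherKindsSpecies.otherClause_of_species`; nothing two-run. -/
theorem finestStepModConst_of_species {Φ : ℕ → ℝ → σ → ι → ℝ} {e ρ : ℕ → ℝ} {α β : ℕ → ℝ → σ → ℝ}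
    (hoA : ∀ K t τ v, L.oA'' K t τ v = Real.exp (α K t τ))
    (hoB : ∀ K t τ v, L.oB'' K t τ v = Real.exp (Φ K t τ v + e K) * Real.exp (β K t τ))
    (hcO : ∀ K t τ, L.cO'' K t τ = e K + (β K t τ - α K t τ)) (hRO : ∀ K t τ, L.RO'' K t τ = vol * ρ K) (hrO : L.rO'' = ρ)
    (hΦ : ∀ K t, |t| ≤ l₀ → ∀ τ ∈ T K \ Bad K t, ∀ v ∈ R.dom, |Φ K t τ v| ≤ vol * ρ K) (hρ : Summable ρ)
    (hdev : ∃ b₀ s : ℕ → ℝ, Summable s ∧ ∀ K t, |t| ≤ l₀ → ∀ τ ∈ T K \ Bad K t, |β K t τ - α K t τ - b₀ K| ≤ vol * s K) :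
    FinestStepModConst L l₀ vol T Bad R := by
  obtain ⟨-, hoth, hRle, hsum, hcdev⟩ := otherClause_of_species (dom := R.dom) (l₀ := l₀) (T := T) (Bad := Bad) hoA hoB hΦ hρ hdev
  refine ⟨fun K t ht τ hτ v hv => ?_, fun K t ht τ hτ => ?_, hrO ▸ hsum, ?_⟩
  · rw [hcO, hRO]; exact hoth K t ht τ hτ v hv
  · rw [hRO, hrO]
  · obtain ⟨c₀, s, hs, h⟩ := hcdev
    exact ⟨c₀, s, hs, fun K t ht τ hτ => by rw [hcO]; exact h K t ht τ hτ⟩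

/-- **THE FRAME's ONE ESTIMATE FROM THE SPECIES DATA, THE CONSTANTS' DEVIATION READ OFF THE WINDOW LETTERS** [bookkeeping] —
`finestStepModConst_of_species` with (γ)'s deviation PRODUCED from the recent-ledger letters (`N19OtherKindsSpecies.constDev_le_windowSum`): the
operations `ops K t τ ⊆ AllO K` booked on the good term, weights `wO ≥ 0` on `AllO K`, full-torus `Multiplicity (AllO K) scO wO Cw vol Λ K`, `RecentOnly`
down to `jlogOf Cl K`, per-operation constant log-ratios `|cn K t τ i| ≤ Cn·θ′^{scO i}·wO i` ([Balaban1989LargeFieldII] p. 380's `O(1)·log g_j⁻²·|Z_j|` form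
after the log-Lipschitz step and rate worsening — `N19OtherKindsSpecies.pow_mul_geometric_le_geometric`), `0 ≤ Cn`, `0 < θ′ < 1`, `1 ≤ Λ`, `0 ≤ Cl`, and
the split `β K t τ − α K t τ = b₀ K + Σ_{i ∈ ops K t τ} cn K t τ i`.  Conclusion: `FinestStepModConst L l₀ vol T Bad R`. -/
theorem finestStepModConst_of_species_windowSum {F' : Type*} {Φ : ℕ → ℝ → σ → ι → ℝ} {e ρ : ℕ → ℝ} {α β : ℕ → ℝ → σ → ℝ}
    {ops : ℕ → ℝ → σ → Finset F'} {AllO : ℕ → Finset F'} {scO : F' → ℕ} {wO : F' → ℝ} {cn : ℕ → ℝ → σ → F' → ℝ}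
    {Cn θ' Cw Λ Cl : ℝ} {b₀ : ℕ → ℝ}
    (hoA : ∀ K t τ v, L.oA'' K t τ v = Real.exp (α K t τ))
    (hoB : ∀ K t τ v, L.oB'' K t τ v = Real.exp (Φ K t τ v + e K) * Real.exp (β K t τ))
    (hcO : ∀ K t τ, L.cO'' K t τ = e K + (β K t τ - α K t τ)) (hRO : ∀ K t τ, L.RO'' K t τ = vol * ρ K) (hrO : L.rO'' = ρ)
    (hΦ : ∀ K t, |t| ≤ l₀ → ∀ τ ∈ T K \ Bad K t, ∀ v ∈ R.dom, |Φ K t τ v| ≤ vol * ρ K) (hρ : Summable ρ)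
    (hsub : ∀ K t, |t| ≤ l₀ → ∀ τ ∈ T K \ Bad K t, ops K t τ ⊆ AllO K) (hw : ∀ K, ∀ i ∈ AllO K, 0 ≤ wO i)
    (hM : ∀ K, Multiplicity (AllO K) scO wO Cw vol Λ K)
    (hrec : ∀ K t, |t| ≤ l₀ → ∀ τ ∈ T K \ Bad K t, RecentOnly (ops K t τ) scO (jlogOf Cl K) K)
    (hcn : ∀ K t, |t| ≤ l₀ → ∀ τ ∈ T K \ Bad K t, ∀ i ∈ ops K t τ, |cn K t τ i| ≤ Cn * θ' ^ scO i * wO i)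
    (hCn : 0 ≤ Cn) (hθ0 : 0 < θ') (hθ1 : θ' < 1) (hΛ : 1 ≤ Λ) (hCl : 0 ≤ Cl)
    (hsplit : ∀ K t, |t| ≤ l₀ → ∀ τ ∈ T K \ Bad K t, β K t τ - α K t τ = b₀ K + ∑ i ∈ ops K t τ, cn K t τ i) :
    FinestStepModConst L l₀ vol T Bad R := by
  obtain ⟨-, hoth, hRle, hsum, hcdev⟩ := otherClause_of_species_windowSum (dom := R.dom) (l₀ := l₀) (T := T) (Bad := Bad)
    hoA hoB hΦ hρ hsub hw hM hrec hcn hCn hθ0 hθ1 hΛ hCl hsplit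
  refine ⟨fun K t ht τ hτ v hv => ?_, fun K t ht τ hτ => ?_, hrO ▸ hsum, ?_⟩
  · rw [hcO, hRO]; exact hoth K t ht τ hτ v hv
  · rw [hRO, hrO]
  · obtain ⟨c₀, s, hs, h⟩ := hcdev
    exact ⟨c₀, s, hs, fun K t ht τ hτ => by rw [hcO]; exact h K t ht τ hτ⟩

/-- **THE POSITIVITY CLAUSE `posO`** of `N19LedgerPieces.LedgerOtherKinds` ∕ `N19LedgerLinkSync.LedgerAtSync` for the species forms: both remaining-kinds
factors are exponentials, hence positive for every admissible datum. [bookkeeping] -/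
theorem posO_of_species {Φ : ℕ → ℝ → σ → ι → ℝ} {e : ℕ → ℝ} {α β : ℕ → ℝ → σ → ℝ}
    (hoA : ∀ K t τ v, L.oA'' K t τ v = Real.exp (α K t τ))
    (hoB : ∀ K t τ v, L.oB'' K t τ v = Real.exp (Φ K t τ v + e K) * Real.exp (β K t τ)) :
    ∀ K t, |t| ≤ l₀ → ∀ τ ∈ T K \ Bad K t, ∀ v ∈ R.dom, 0 < L.oA'' K t τ v ∧ 0 < L.oB'' K t τ v := by
  intro K t _ τ _ v _
  rw [hoA, hoB]
  exact ⟨Real.exp_pos _, mul_pos (Real.exp_pos _) (Real.exp_pos _)⟩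

end Summit.QuantumFields.YangMills.BalabanUVNodes.N19FinestStepSpecies

end
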